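import Summits.Ventures.Crystal3D.Theorems.StickyWulffConstantGenericWallFloorExactOnly
import Literature.Geometry.DiscreteGeometry.EtaMatching
import HarnessLib

/-!
# One- and two-centre EXCLUSION FORMATS for the flat-face row ledger (SLOTEX-J2 `J0` / `ONE(η)` in the kernel)

Helper for `stmt-Ventures-19480` / `19483` (cf-p1 ROUTE.md §82(5b) «second-row transfer», §82(7) asks
R40a/R40b; lit g12).  The certified computations of R39a/R40b are INFEASIBILITY statements for one or
two surface balls of a half-space grain with the grain balls as fixed obstacles:
* `J0(b; η)` infeasible — «`b` saturated with a designated contact `≥ η` off every slot of `b`» is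
  impossible (rows 1735 + a-face, 615 + m-face: exact-only AGAINST THE LATTICE although 1735 is a
  violator in isolation);
* `ONE(b₁, b₂; η)` infeasible — «`b₁` saturated `η`-non-exactly AND `b₂` saturated at all» is
  impossible (the four 30A classes (1743|1743) d = 1.633, 1.915 and (1743|4062) d = 1, 1.732).
This file states them as `Prop`s quantified over configurations `X` (the form the ledger lemmas
consume, cf. `unsaturated_of_exactOnly`, `DoubleStarCoaxialAt`):
`SaturationExcluded b F slots η` and `TwoCentreOneExcluded b₁ b₂ F slots₁ η` (`F` = the fixed grain
balls, `slots` = the twelve lattice slots of the centre, the designated contact `y` is `> η` from EVERY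
slot — occupied slots included, which for `η < 1` only says `y` is not an own ball), and proves the
GLUE to the inside-tube theorems: by `Literature…EtaMatching` (Hall, disjoint case) a saturated ball
with a vacant slot whose free contacts are NOT the vacant slots has a contact `> η` off every slot as
soon as «free contacts `η`-matched to the vacant slots ⇒ equal» — which is exactly what the landed cone
certificates give for `η <` the certified tube radius `ρ` (`ConeCert.eq_slotSet_of_etaMatched`,
`cert_A12_1743_rho` ρ = 0.145, `cert_A12_1735_rho` 0.127, `cert_A12_615_rho` 0.114, transported to the
centre's frame as in `…ExhaustionGlue` / `…StarTransport`).  Hence the B&B may be run at `η` just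
below `ρ` (dyadic `9/64`, `1/8`, `7/64`) instead of `κ₀/3 = 0.029`: numerical margins (cf-p1 SLOTEX-J2,
kit j292745/j293681) ≈ −0.03 rad at η = .15 versus −0.006 at .029.
THEOREMS: `exists_far_contact` (the common step), `unsaturated_of_saturationExcluded`,
`unsaturated_of_twoCentreOneExcluded` (= the second-row transfer: `b₂` saturated ⇒ … no: `b₁` a
saturated top ⇒ `b₂` unsaturated), monotonicity in `F` and `η`.  Concrete integer data and the named
`Prop`s per class: `…TwoCentreExclusionData.lean`.

WHAT THIS IS NOT: no certificate is proved here (the Props are the B&B's obligations); flat-face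
benchmark vocabulary only (general fillings: T's v7, R40g); rung F-C1 not moved.
-/

noncomputable section

namespace Summit.Ventures.Crystal3D.Theorems

open Finset Literature.Geometry.DiscreteGeometry

/-- **ONE-CENTRE EXCLUSION** (`J0(b; η)` infeasible with the fixed balls `F` present): in every
`1`-separated configuration `X ⊇ F`, the ball `b` is NOT saturated with a designated contact `y` at
distance `> η` from every slot of `b`. -/
def SaturationExcluded (b : EuclideanSpace ℝ (Fin 3)) (F slots : Finset (EuclideanSpace ℝ (Fin 3)))
    (η : ℝ) : Prop :=
  ∀ X : Finset (EuclideanSpace ℝ (Fin 3)), (∀ p ∈ X, ∀ q ∈ X, p ≠ q → 1 ≤ dist p q) → F ⊆ X →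
    (X.filter fun q => dist b q = 1).card = 12 →
    (∃ y ∈ X, dist b y = 1 ∧ ∀ s ∈ slots, η < dist y s) → False

/-- **TWO-CENTRE ONE-SIDED EXCLUSION** (`ONE(b₁, b₂; η)` infeasible with the fixed balls `F`
present): in every `1`-separated configuration `X ⊇ F` in which `b₁` is saturated with a designated
contact `> η` off every slot of `b₁`, the ball `b₂` has at most eleven contacts. -/
def TwoCentreOneExcluded (b₁ b₂ : EuclideanSpace ℝ (Fin 3))
    (F slots₁ : Finset (EuclideanSpace ℝ (Fin 3))) (η : ℝ) : Prop :=
  ∀ X : Finset (EuclideanSpace ℝ (Fin 3)), (∀ p ∈ X, ∀ q ∈ X, p ≠ q → 1 ≤ dist p q) → F ⊆ X →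
    (X.filter fun q => dist b₁ q = 1).card = 12 →
    (∃ y ∈ X, dist b₁ y = 1 ∧ ∀ s ∈ slots₁, η < dist y s) →
    (X.filter fun q => dist b₂ q = 1).card ≤ 11

/-- More fixed balls only weaken the obligation. -/
theorem SaturationExcluded.mono {b : EuclideanSpace ℝ (Fin 3)} {F F' slots : Finset (EuclideanSpace ℝ (Fin 3))}
    {η : ℝ} (h : SaturationExcluded b F slots η) (hF : F ⊆ F') : SaturationExcluded b F' slots η :=
  fun X hX hF' hsat hy => h X hX (hF.trans hF') hsat hy

/-- A larger `η` only weakens the obligation. -/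
theorem SaturationExcluded.of_le {b : EuclideanSpace ℝ (Fin 3)} {F slots : Finset (EuclideanSpace ℝ (Fin 3))}
    {η η' : ℝ} (h : SaturationExcluded b F slots η) (hη : η ≤ η') : SaturationExcluded b F slots η' :=
  fun X hX hF hsat ⟨y, hy, hy1, hfar⟩ => h X hX hF hsat ⟨y, hy, hy1, fun s hs => lt_of_le_of_lt hη (hfar s hs)⟩

/-- More fixed balls only weaken the obligation. -/
theorem TwoCentreOneExcluded.mono {b₁ b₂ : EuclideanSpace ℝ (Fin 3)}
    {F F' slots₁ : Finset (EuclideanSpace ℝ (Fin 3))} {η : ℝ} (h : TwoCentreOneExcluded b₁ b₂ F slots₁ η)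
    (hF : F ⊆ F') : TwoCentreOneExcluded b₁ b₂ F' slots₁ η :=
  fun X hX hF' hsat hy => h X hX (hF.trans hF') hsat hy

/-- A larger `η` only weakens the obligation. -/
theorem TwoCentreOneExcluded.of_le {b₁ b₂ : EuclideanSpace ℝ (Fin 3)}
    {F slots₁ : Finset (EuclideanSpace ℝ (Fin 3))} {η η' : ℝ} (h : TwoCentreOneExcluded b₁ b₂ F slots₁ η)
    (hη : η ≤ η') : TwoCentreOneExcluded b₁ b₂ F slots₁ η' :=
  fun X hX hF hsat ⟨y, hy, hy1, hfar⟩ =>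
    h X hX hF hsat ⟨y, hy, hy1, fun s hs => lt_of_le_of_lt hη (hfar s hs)⟩

/-- **The common step: a saturated ball with a vacant slot has a FAR contact** as soon as the
inside-tube statement holds at radius `η < 1/2`.  `slots` = twelve points at distance `1` from `b`;
`htube`: every twelve-ball kissing shell `N ⊇ slots ∩ X` around `b` whose free part is `η`-matched to
the vacant slots has free part EQUAL to the vacant slots (delivered by `ConeCert.eq_slotSet_of_etaMatched`
for the own pattern `slots ∩ X`, `η < ρ`).  Then, if `b` has twelve contacts in `X` and some slot is
vacant, some contact `y` of `b` is at distance `> η` from every slot. -/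
theorem exists_far_contact (X : Finset (EuclideanSpace ℝ (Fin 3)))
    (hX : ∀ p ∈ X, ∀ q ∈ X, p ≠ q → 1 ≤ dist p q)
    (b : EuclideanSpace ℝ (Fin 3)) (slots : Finset (EuclideanSpace ℝ (Fin 3)))
    (hcard : slots.card = 12) (hslots : ∀ s ∈ slots, dist b s = 1) {η : ℝ} (hη : η < 1 / 2)
    (htube : ∀ N : Finset (EuclideanSpace ℝ (Fin 3)), slots ∩ X ⊆ N → N.card = 12 →
      IsKissingAround b N → EtaMatched η (N \ (slots ∩ X)) (slots \ X) → N \ (slots ∩ X) = slots \ X)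
    (hsat : (X.filter fun q => dist b q = 1).card = 12) (hempty : ∃ s ∈ slots, s ∉ X) :
    ∃ y ∈ X, dist b y = 1 ∧ ∀ s ∈ slots, η < dist y s := by
  classical
  set N := X.filter fun q => dist b q = 1 with hN
  set O := slots ∩ X with hO
  have hkiss : IsKissingAround b N := by
    refine ⟨fun s hs => (Finset.mem_filter.mp hs).2, fun s hs t ht hst => ?_⟩
    exact hX s (Finset.mem_filter.mp hs).1 t (Finset.mem_filter.mp ht).1 hst
  have hON : O ⊆ N := by
    intro s hs
    obtain ⟨hs1, hs2⟩ := Finset.mem_inter.mp hs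
    exact Finset.mem_filter.mpr ⟨hs2, hslots s hs1⟩
  -- cardinalities: |N \ O| = |slots \ X|
  have hcO : (N \ O).card = 12 - O.card := by
    have h := Finset.card_sdiff_add_card_inter N O
    rw [Finset.inter_eq_right.mpr hON, hsat] at h
    omega
  have hcS : (slots \ X).card = 12 - O.card := by
    have h := Finset.card_sdiff_add_card_inter slots X
    rw [hcard] at h
    rw [hO]; omega
  have hTcard : (N \ O).card = (slots \ X).card := by rw [hcO, hcS]
  -- the free part is not η-matched to the vacant slots (a vacant slot would be occupied)
  have hnot : ¬ EtaMatched η (N \ O) (slots \ X) := by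
    intro hm
    have heq : N \ O = slots \ X := htube N hON hsat hkiss hm
    obtain ⟨s, hs, hsX⟩ := hempty
    have hs' : s ∈ slots \ X := Finset.mem_sdiff.mpr ⟨hs, hsX⟩
    rw [← heq] at hs'
    exact hsX (Finset.mem_filter.mp (Finset.mem_sdiff.mp hs').1).1
  -- separation of the free part
  have hsep : ∀ t ∈ N \ O, ∀ t' ∈ N \ O, t ≠ t' → 2 * η < dist t t' := by
    intro t ht t' ht' hne
    have h1 := hX t (Finset.mem_filter.mp (Finset.mem_sdiff.mp ht).1).1 t'
      (Finset.mem_filter.mp (Finset.mem_sdiff.mp ht').1).1 hne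
    linarith
  obtain ⟨y, hy, hfar⟩ := exists_forall_lt_dist_of_not_etaMatched hTcard hsep hnot
  have hyN : y ∈ N := (Finset.mem_sdiff.mp hy).1
  have hyO : y ∉ O := (Finset.mem_sdiff.mp hy).2
  have hyX : y ∈ X := (Finset.mem_filter.mp hyN).1
  refine ⟨y, hyX, (Finset.mem_filter.mp hyN).2, fun s hs => ?_⟩
  by_cases hsX : s ∈ X
  · -- occupied slot: `y ≠ s` (else `y ∈ O`) and both lie in `X`
    have hne : y ≠ s := by
      intro h; apply hyO; rw [h]; exact Finset.mem_inter.mpr ⟨hs, hsX⟩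
    have h1 := hX y hyX s hsX hne
    linarith
  · exact hfar s (Finset.mem_sdiff.mpr ⟨hs, hsX⟩)

/-- **One-centre glue** (rows 1735 + a-face, 615 + m-face): `SaturationExcluded` with the grain
balls `F ⊆ X` and the inside-tube statement at `η` ⇒ a ball `b` with a vacant slot is UNSATURATED. -/
theorem unsaturated_of_saturationExcluded {b : EuclideanSpace ℝ (Fin 3)}
    {F slots : Finset (EuclideanSpace ℝ (Fin 3))} {η : ℝ} (hexcl : SaturationExcluded b F slots η)
    (X : Finset (EuclideanSpace ℝ (Fin 3))) (hX : ∀ p ∈ X, ∀ q ∈ X, p ≠ q → 1 ≤ dist p q) (hF : F ⊆ X)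
    (hcard : slots.card = 12) (hslots : ∀ s ∈ slots, dist b s = 1) (hη : η < 1 / 2)
    (htube : ∀ N : Finset (EuclideanSpace ℝ (Fin 3)), slots ∩ X ⊆ N → N.card = 12 →
      IsKissingAround b N → EtaMatched η (N \ (slots ∩ X)) (slots \ X) → N \ (slots ∩ X) = slots \ X)
    (hempty : ∃ s ∈ slots, s ∉ X) :
    (X.filter fun q => dist b q = 1).card ≤ 11 := by
  classical
  by_contra hlt
  push Not at hlt
  have hkiss : IsKissingAround b (X.filter fun q => dist b q = 1) := by
    refine ⟨fun s hs => (Finset.mem_filter.mp hs).2, fun s hs t ht hst => ?_⟩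
    exact hX s (Finset.mem_filter.mp hs).1 t (Finset.mem_filter.mp ht).1 hst
  have hsat : (X.filter fun q => dist b q = 1).card = 12 := le_antisymm hkiss.card_le_twelve (by omega)
  exact hexcl X hX hF hsat (exists_far_contact X hX b slots hcard hslots hη htube hsat hempty)

/-- **Two-centre glue = the SECOND-ROW TRANSFER** (30A classes): `TwoCentreOneExcluded` with the
grain balls `F ⊆ X`, the inside-tube statement for `b₁` at `η`, `b₁` saturated with a vacant slot
(a saturated line top) ⇒ `b₂` is UNSATURATED. -/
theorem unsaturated_of_twoCentreOneExcluded {b₁ b₂ : EuclideanSpace ℝ (Fin 3)}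
    {F slots₁ : Finset (EuclideanSpace ℝ (Fin 3))} {η : ℝ} (hexcl : TwoCentreOneExcluded b₁ b₂ F slots₁ η)
    (X : Finset (EuclideanSpace ℝ (Fin 3))) (hX : ∀ p ∈ X, ∀ q ∈ X, p ≠ q → 1 ≤ dist p q) (hF : F ⊆ X)
    (hcard : slots₁.card = 12) (hslots : ∀ s ∈ slots₁, dist b₁ s = 1) (hη : η < 1 / 2)
    (htube : ∀ N : Finset (EuclideanSpace ℝ (Fin 3)), slots₁ ∩ X ⊆ N → N.card = 12 →
      IsKissingAround b₁ N → EtaMatched η (N \ (slots₁ ∩ X)) (slots₁ \ X) →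
      N \ (slots₁ ∩ X) = slots₁ \ X)
    (hsat : (X.filter fun q => dist b₁ q = 1).card = 12) (hempty : ∃ s ∈ slots₁, s ∉ X) :
    (X.filter fun q => dist b₂ q = 1).card ≤ 11 :=
  hexcl X hX hF hsat (exists_far_contact X hX b₁ slots₁ hcard hslots hη htube hsat hempty)

/-- Contrapositive bookkeeping form of the transfer: if `b₂` is saturated then the top `b₁` is not. -/
theorem card_le_eleven_of_twoCentreOneExcluded_of_saturated {b₁ b₂ : EuclideanSpace ℝ (Fin 3)}
    {F slots₁ : Finset (EuclideanSpace ℝ (Fin 3))} {η : ℝ} (hexcl : TwoCentreOneExcluded b₁ b₂ F slots₁ η)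
    (X : Finset (EuclideanSpace ℝ (Fin 3))) (hX : ∀ p ∈ X, ∀ q ∈ X, p ≠ q → 1 ≤ dist p q) (hF : F ⊆ X)
    (hcard : slots₁.card = 12) (hslots : ∀ s ∈ slots₁, dist b₁ s = 1) (hη : η < 1 / 2)
    (htube : ∀ N : Finset (EuclideanSpace ℝ (Fin 3)), slots₁ ∩ X ⊆ N → N.card = 12 →
      IsKissingAround b₁ N → EtaMatched η (N \ (slots₁ ∩ X)) (slots₁ \ X) →
      N \ (slots₁ ∩ X) = slots₁ \ X)
    (hempty : ∃ s ∈ slots₁, s ∉ X) (hsat₂ : (X.filter fun q => dist b₂ q = 1).card = 12) :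
    (X.filter fun q => dist b₁ q = 1).card ≤ 11 := by
  classical
  by_contra hlt
  push Not at hlt
  have hkiss : IsKissingAround b₁ (X.filter fun q => dist b₁ q = 1) := by
    refine ⟨fun s hs => (Finset.mem_filter.mp hs).2, fun s hs t ht hst => ?_⟩
    exact hX s (Finset.mem_filter.mp hs).1 t (Finset.mem_filter.mp ht).1 hst
  have hsat : (X.filter fun q => dist b₁ q = 1).card = 12 := le_antisymm hkiss.card_le_twelve (by omega)
  have := unsaturated_of_twoCentreOneExcluded hexcl X hX hF hcard hslots hη htube hsat hempty
  omega

end Summit.Ventures.Crystal3D.Theorems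

end
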